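import Mathlib.MeasureTheory.Integral.Bochner.Basic
import Mathlib.MeasureTheory.Group.Integral
import Mathlib.MeasureTheory.Measure.Haar.OfBasis
import HarnessLib

/-!
# Rung R3 of line `LayerChain` v4 (crux `StackingLiminf`, stmt-Ventures-19145): the sharp triangle
# inequality with cancellation for sums of translates of a bump

Cell `crystal3d-full`, venture `Summits/Ventures/Crystal3D`.  Planner rung `rung_sum_translate_sub_l1`
(`HOME/cf-p1/route/lines/LayerChainV4Rungs.lean`, R3 [M], the exact-constant front end of stub (B)
`MollifiedUpper`), VERBATIM signature:

two finite sums of translates of a nonnegative integrable bump differ in `L¹` by at most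
(number of unmatched centres) × (mass of the bump) — matched centres cancel one-to-one:
`∫ |Σ_{p ∈ P} φ(y − p) − Σ_{q ∈ Q} φ(y − q)| dy ≤ (#(P∖Q) + #(Q∖P)) · ∫ φ`.

Applied per directed bond class `c` with `P = X_k + c`, `Q = X_{k+1}` (or `Q = X_k` in-plane) and summed
over the classes it gives `Σ_classes ‖v(· − c) − v‖₁ ≤ 2D · (1/√2) = √2·D`; the unmatched centres are
exactly the broken bonds / run tops counted in `…StackingLiminfBondSlots.lean` (p504513).
WHAT THIS IS NOT: nothing crystal-specific; pure measure theory on `Fin 3 → ℝ`.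
-/

noncomputable section

namespace Summit.Ventures.Crystal3D.Theorems

open MeasureTheory Finset

/-- **R3 — sharp triangle inequality with cancellation.**  For finite `P, Q ⊆ ℝ³` and a nonnegative
integrable `φ`: `∫ |Σ_{p∈P} φ(y−p) − Σ_{q∈Q} φ(y−q)| dy ≤ (#(P∖Q) + #(Q∖P)) · ∫ φ`. -/
theorem rung_sum_translate_sub_l1 (P Q : Finset (Fin 3 → ℝ)) (φ : (Fin 3 → ℝ) → ℝ)
    (hφ0 : ∀ u, 0 ≤ φ u) (hφi : Integrable φ) :
    ∫ y, |∑ p ∈ P, φ (y - p) - ∑ q ∈ Q, φ (y - q)| ≤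
      (((P \ Q).card + (Q \ P).card : ℕ) : ℝ) * ∫ u, φ u := by
  -- matched centres cancel
  have hsplit : ∀ y : Fin 3 → ℝ, ∑ p ∈ P, φ (y - p) - ∑ q ∈ Q, φ (y - q) =
      ∑ p ∈ P \ Q, φ (y - p) - ∑ q ∈ Q \ P, φ (y - q) := fun y =>
    (sum_sdiff_sub_sum_sdiff (s₁ := Q) (s₂ := P) (f := fun p => φ (y - p))).symm
  -- pointwise: |a − b| ≤ a + b for nonnegative a, b
  have hpt : ∀ y : Fin 3 → ℝ, |∑ p ∈ P, φ (y - p) - ∑ q ∈ Q, φ (y - q)| ≤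
      ∑ p ∈ P \ Q, φ (y - p) + ∑ q ∈ Q \ P, φ (y - q) := by
    intro y
    rw [hsplit y]
    have ha : 0 ≤ ∑ p ∈ P \ Q, φ (y - p) := sum_nonneg fun p _ => hφ0 _
    have hb : 0 ≤ ∑ q ∈ Q \ P, φ (y - q) := sum_nonneg fun q _ => hφ0 _
    rw [abs_sub_le_iff]
    constructor <;> linarith
  -- integrability of the right-hand side
  have htr : ∀ p : Fin 3 → ℝ, Integrable fun y : Fin 3 → ℝ => φ (y - p) := fun p =>
    hφi.comp_sub_right p
  have hint : Integrable fun y : Fin 3 → ℝ =>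
      ∑ p ∈ P \ Q, φ (y - p) + ∑ q ∈ Q \ P, φ (y - q) :=
    (integrable_finsetSum _ fun p _ => htr p).add (integrable_finsetSum _ fun q _ => htr q)
  calc ∫ y, |∑ p ∈ P, φ (y - p) - ∑ q ∈ Q, φ (y - q)|
      ≤ ∫ y, (∑ p ∈ P \ Q, φ (y - p) + ∑ q ∈ Q \ P, φ (y - q)) :=
        integral_mono_of_nonneg (Filter.Eventually.of_forall fun y => abs_nonneg _) hint
          (Filter.Eventually.of_forall hpt)
    _ = (∑ p ∈ P \ Q, ∫ y, φ (y - p)) + ∑ q ∈ Q \ P, ∫ y, φ (y - q) := by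
        rw [integral_add (integrable_finsetSum _ fun p _ => htr p)
          (integrable_finsetSum _ fun q _ => htr q),
          integral_finsetSum _ (fun p _ => htr p), integral_finsetSum _ (fun q _ => htr q)]
    _ = (∑ _p ∈ P \ Q, ∫ u, φ u) + ∑ _q ∈ Q \ P, ∫ u, φ u := by
        simp_rw [integral_sub_right_eq_self φ]
    _ = (((P \ Q).card + (Q \ P).card : ℕ) : ℝ) * ∫ u, φ u := by
        rw [sum_const, sum_const, nsmul_eq_mul, nsmul_eq_mul, Nat.cast_add]
        ring

end Summit.Ventures.Crystal3D.Theorems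

end
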